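import Mathlib.LinearAlgebra.Matrix.PosDef
import Mathlib.Analysis.SpecialFunctions.Pow.Real

/-!
# Route `WeakCouplingRates`, crux `ColdBoxTwoPointFloorW`, stub S4 `stub_boxKernelVsLattice`: the projection
# algebra of a Gram kernel `K(p,q) = λ_p · Q⁻¹ λ_q`, `Q = Σ_{p ∈ P} λ_p λ_pᵀ`

Helper file (fleet seat `ym-wcr-19608-p2`, item stmt-QuantumFields-19608).  The free comb-gauge box Maxwell
kernel `boxMaxwellPlaqCov H T` is the matrix element `λ_p · Q⁻¹ λ_q` of the inverse precision matrix
`Q = Σ_{p ∈ P} λ_p λ_pᵀ` of the box (tree: `LatticeMaxwell.Qmat`, `integral_boxCirc_mul_boxCirc`), i.e. the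
kernel of the ORTHOGONAL PROJECTION of `ℝ^P` onto the range of the curl `s ↦ (λ_p · s)_{p ∈ P}`.  This file
proves, for an abstract finite family `λ : α → ι → ℝ` and any invertible `Q = Σ_{p∈P} λ_p λ_pᵀ`, the four
properties of `K` that the comparison with the `ℤ⁴` kernel uses:

* `gramKernel_reproducing` — `Σ_{p'∈P} K(p,p') (λ_{p'}·s) = λ_p·s` (K is the identity on curls);
* `gramKernel_comm` — symmetry; `gramKernel_annihilates` — `K` kills every `n ∈ ℝ^P` orthogonal to all curls;
* `gramKernel_idem` — `Σ_{p'} K(p,p')K(p',q) = K(p,q)`;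
* `abs_sum_sum_gramKernel_le` — `|Σ_{p,p'} v_p K(p,p') w_{p'}| ≤ ‖v‖ ‖w‖` (a projection is a contraction);

and the resulting **comparison identity with error** `abs_gramKernel_sub_le`: if on `P` the point mass `δ_q`
splits as `λ·s_q + n_q + v_q` with `n_q` orthogonal to curls (and likewise for `p`), then
`|K(p,q) − λ_p·s_q| ≤ Σ_{p'∈P} |λ_{p'}·s_p| |v_q(p')| + ‖v_p‖ ‖v_q‖`.
Pure finite-dimensional linear algebra; no measure theory.  NOT a claim about the mass gap.
-/

set_option autoImplicit false

namespace Summit.QuantumFields.YangMills.Theorems.WeakCouplingRates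

open Matrix Finset

variable {ι α : Type*} [Fintype ι]

section GramKernel

variable (P : Finset α) (lam : α → ι → ℝ) (Q : Matrix ι ι ℝ) (K : α → α → ℝ)

/-- `(Σ_{p∈P} λ_p λ_pᵀ) s = Σ_{p∈P} (λ_p · s) λ_p`. -/
theorem sum_vecMulVec_mulVec (s : ι → ℝ) :
    (∑ p ∈ P, vecMulVec (lam p) (lam p)) *ᵥ s = ∑ p ∈ P, (lam p ⬝ᵥ s) • lam p := by
  rw [Matrix.sum_mulVec]
  refine Finset.sum_congr rfl fun p _ => ?_
  ext i
  simp only [Matrix.mulVec, vecMulVec_apply, dotProduct, Pi.smul_apply, smul_eq_mul, Finset.sum_mul]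
  exact Finset.sum_congr rfl fun j _ => by ring

variable {P lam Q K}

/-- Orthogonality of curls to the annihilated vectors, in the form used below:
`Σ_{p'∈P} (λ_{p'}·s) n(p') = 0`. -/
theorem sum_curl_mul_eq_zero {n : α → ℝ} (hn : ∀ s : ι → ℝ, ∑ p' ∈ P, n p' * (lam p' ⬝ᵥ s) = 0)
    (s : ι → ℝ) : ∑ p' ∈ P, (lam p' ⬝ᵥ s) * n p' = 0 := by
  rw [← hn s]
  exact Finset.sum_congr rfl fun p' _ => mul_comm _ _

variable [DecidableEq ι]


/-- The inverse of the (symmetric) Gram matrix is symmetric. -/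
theorem gram_inv_transpose (hQ : Q = ∑ p ∈ P, vecMulVec (lam p) (lam p)) : (Q⁻¹)ᵀ = Q⁻¹ := by
  rw [Matrix.transpose_nonsing_inv]
  congr 1
  rw [hQ, Matrix.transpose_sum]
  exact Finset.sum_congr rfl fun p _ => by rw [Matrix.transpose_vecMulVec]

/-- **Symmetry** `K(p,q) = K(q,p)`. -/
theorem gramKernel_comm (hQ : Q = ∑ p ∈ P, vecMulVec (lam p) (lam p))
    (hK : ∀ p q, K p q = lam p ⬝ᵥ Q⁻¹ *ᵥ lam q) (p q : α) : K p q = K q p := by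
  rw [hK, hK, Matrix.dotProduct_mulVec, ← Matrix.mulVec_transpose, gram_inv_transpose hQ,
    dotProduct_comm]

/-- **Reproducing property**: `Σ_{p'∈P} K(p,p') (λ_{p'} · s) = λ_p · s` — the kernel acts as the identity on
the range of the curl map `s ↦ (λ_p · s)_p`. -/
theorem gramKernel_reproducing (hQ : Q = ∑ p ∈ P, vecMulVec (lam p) (lam p)) (hQd : Q.PosDef)
    (hK : ∀ p q, K p q = lam p ⬝ᵥ Q⁻¹ *ᵥ lam q) (s : ι → ℝ) (p : α) :
    ∑ p' ∈ P, K p p' * (lam p' ⬝ᵥ s) = lam p ⬝ᵥ s := by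
  have hunit : IsUnit Q.det := (Matrix.isUnit_iff_isUnit_det _).1 hQd.isUnit
  have h1 : ∑ p' ∈ P, K p p' * (lam p' ⬝ᵥ s) = lam p ⬝ᵥ Q⁻¹ *ᵥ (∑ p' ∈ P, (lam p' ⬝ᵥ s) • lam p') := by
    rw [Matrix.mulVec_sum, dotProduct_sum]
    refine Finset.sum_congr rfl fun p' _ => ?_
    rw [hK, Matrix.mulVec_smul, dotProduct_smul, smul_eq_mul, mul_comm]
  rw [h1, ← sum_vecMulVec_mulVec, ← hQ, Matrix.mulVec_mulVec, Matrix.nonsing_inv_mul _ hunit,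
    Matrix.one_mulVec]

/-- **Idempotence** `Σ_{p'∈P} K(p,p') K(p',q) = K(p,q)` (the kernel is a projection). -/
theorem gramKernel_idem (hQ : Q = ∑ p ∈ P, vecMulVec (lam p) (lam p)) (hQd : Q.PosDef)
    (hK : ∀ p q, K p q = lam p ⬝ᵥ Q⁻¹ *ᵥ lam q) (p q : α) :
    ∑ p' ∈ P, K p p' * K p' q = K p q := by
  have h : ∀ p', K p' q = lam p' ⬝ᵥ (Q⁻¹ *ᵥ lam q) := fun p' => hK p' q
  simp_rw [h]
  exact gramKernel_reproducing hQ hQd hK _ p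

/-- The kernel **annihilates every vector orthogonal to all curls**: if `Σ_{p'∈P} n(p') (λ_{p'}·s) = 0` for all
`s`, then `Σ_{p'∈P} K(p,p') n(p') = 0`. -/
theorem gramKernel_annihilates (hQ : Q = ∑ p ∈ P, vecMulVec (lam p) (lam p))
    (hK : ∀ p q, K p q = lam p ⬝ᵥ Q⁻¹ *ᵥ lam q) {n : α → ℝ}
    (hn : ∀ s : ι → ℝ, ∑ p' ∈ P, n p' * (lam p' ⬝ᵥ s) = 0) (p : α) :
    ∑ p' ∈ P, K p p' * n p' = 0 := by
  have h : ∀ p', K p p' * n p' = n p' * (lam p' ⬝ᵥ (Q⁻¹ *ᵥ lam p)) := fun p' => by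
    rw [gramKernel_comm hQ hK, hK, mul_comm]
  simp_rw [h]
  exact hn _

/-- `⟨v, K w⟩ = ⟨K v, K w⟩` for the symmetric idempotent kernel. -/
theorem sum_mul_gramKernel_eq (hQ : Q = ∑ p ∈ P, vecMulVec (lam p) (lam p)) (hQd : Q.PosDef)
    (hK : ∀ p q, K p q = lam p ⬝ᵥ Q⁻¹ *ᵥ lam q) (v w : α → ℝ) :
    ∑ p ∈ P, ∑ p' ∈ P, v p * K p p' * w p' =
      ∑ p'' ∈ P, (∑ p ∈ P, v p * K p p'') * (∑ p' ∈ P, K p'' p' * w p') := by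
  have hidem : ∀ p p', K p p' = ∑ p'' ∈ P, K p p'' * K p'' p' :=
    fun p p' => (gramKernel_idem hQ hQd hK p p').symm
  calc ∑ p ∈ P, ∑ p' ∈ P, v p * K p p' * w p'
      = ∑ p ∈ P, ∑ p' ∈ P, ∑ p'' ∈ P, v p * K p p'' * (K p'' p' * w p') := by
        refine Finset.sum_congr rfl fun p _ => Finset.sum_congr rfl fun p' _ => ?_
        rw [hidem p p', Finset.mul_sum, Finset.sum_mul]
        exact Finset.sum_congr rfl fun p'' _ => by ring
    _ = ∑ p ∈ P, ∑ p'' ∈ P, ∑ p' ∈ P, v p * K p p'' * (K p'' p' * w p') :=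
        Finset.sum_congr rfl fun p _ => Finset.sum_comm
    _ = ∑ p'' ∈ P, ∑ p ∈ P, ∑ p' ∈ P, v p * K p p'' * (K p'' p' * w p') := Finset.sum_comm
    _ = _ := by
        refine Finset.sum_congr rfl fun p'' _ => ?_
        rw [Finset.sum_mul_sum]

/-- **A projection is a contraction** (Cauchy–Schwarz): `|Σ_{p,p'∈P} v_p K(p,p') w_{p'}| ≤ ‖v‖ ‖w‖`. -/
theorem abs_sum_sum_gramKernel_le (hQ : Q = ∑ p ∈ P, vecMulVec (lam p) (lam p)) (hQd : Q.PosDef)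
    (hK : ∀ p q, K p q = lam p ⬝ᵥ Q⁻¹ *ᵥ lam q) (v w : α → ℝ) :
    |∑ p ∈ P, ∑ p' ∈ P, v p * K p p' * w p'| ≤
      Real.sqrt (∑ p ∈ P, v p ^ 2) * Real.sqrt (∑ p ∈ P, w p ^ 2) := by
  -- `Kv`, `Kw` and the identities `⟨v,Kw⟩ = ⟨Kv,Kw⟩`, `⟨v,Kv⟩ = ‖Kv‖²`
  set Kv : α → ℝ := fun p'' => ∑ p ∈ P, v p * K p p'' with hKv
  set Kw : α → ℝ := fun p'' => ∑ p' ∈ P, K p'' p' * w p' with hKw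
  have hKw' : ∀ p'', Kw p'' = ∑ p' ∈ P, w p' * K p' p'' := fun p'' => by
    simp only [hKw]
    exact Finset.sum_congr rfl fun p' _ => by rw [gramKernel_comm hQ hK, mul_comm]
  have hvw : ∑ p ∈ P, ∑ p' ∈ P, v p * K p p' * w p' = ∑ p'' ∈ P, Kv p'' * Kw p'' :=
    sum_mul_gramKernel_eq hQ hQd hK v w
  -- norms of `Kv`, `Kw` are at most those of `v`, `w`
  have hnorm : ∀ u : α → ℝ, ∑ p'' ∈ P, (∑ p ∈ P, u p * K p p'') ^ 2 ≤ ∑ p ∈ P, u p ^ 2 := by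
    intro u
    set Ku : α → ℝ := fun p'' => ∑ p ∈ P, u p * K p p'' with hKu
    have hKu' : ∀ p'', (∑ p' ∈ P, K p'' p' * u p') = Ku p'' := fun p'' => by
      simp only [hKu]
      exact Finset.sum_congr rfl fun p' _ => by rw [gramKernel_comm hQ hK, mul_comm]
    have huu : ∑ p ∈ P, ∑ p' ∈ P, u p * K p p' * u p' = ∑ p'' ∈ P, Ku p'' * Ku p'' := by
      rw [sum_mul_gramKernel_eq hQ hQd hK u u]
      exact Finset.sum_congr rfl fun p'' _ => by rw [hKu']
    -- `⟨u, Ku⟩ = ‖Ku‖²`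
    have huu' : ∑ p ∈ P, ∑ p' ∈ P, u p * K p p' * u p' = ∑ p' ∈ P, u p' * Ku p' := by
      rw [Finset.sum_comm]
      refine Finset.sum_congr rfl fun p' _ => ?_
      rw [hKu]
      simp only [Finset.mul_sum]
      exact Finset.sum_congr rfl fun p _ => by ring
    have hsq : ∑ p'' ∈ P, Ku p'' ^ 2 = ∑ p' ∈ P, u p' * Ku p' := by
      rw [← huu', huu]
      exact Finset.sum_congr rfl fun p'' _ => by ring
    -- Cauchy–Schwarz: `‖Ku‖² = ⟨u, Ku⟩ ≤ ‖u‖ ‖Ku‖`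
    have hcs : ∑ p' ∈ P, u p' * Ku p' ≤
        Real.sqrt (∑ p' ∈ P, u p' ^ 2) * Real.sqrt (∑ p' ∈ P, Ku p' ^ 2) :=
      Real.sum_mul_le_sqrt_mul_sqrt P u Ku
    have hA : 0 ≤ ∑ p' ∈ P, Ku p' ^ 2 := Finset.sum_nonneg fun _ _ => sq_nonneg _
    have hB : 0 ≤ ∑ p' ∈ P, u p' ^ 2 := Finset.sum_nonneg fun _ _ => sq_nonneg _
    -- `A ≤ √B √A` ⇒ `A ≤ B`
    have h1 : ∑ p' ∈ P, Ku p' ^ 2 ≤ Real.sqrt (∑ p' ∈ P, u p' ^ 2) * Real.sqrt (∑ p' ∈ P, Ku p' ^ 2) :=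
      hsq ▸ hcs
    have h2 : Real.sqrt (∑ p' ∈ P, Ku p' ^ 2) ^ 2 ≤
        Real.sqrt (∑ p' ∈ P, u p' ^ 2) * Real.sqrt (∑ p' ∈ P, Ku p' ^ 2) := by
      rw [Real.sq_sqrt hA]; exact h1
    have h3 : Real.sqrt (∑ p' ∈ P, Ku p' ^ 2) ≤ Real.sqrt (∑ p' ∈ P, u p' ^ 2) := by
      by_cases h0 : Real.sqrt (∑ p' ∈ P, Ku p' ^ 2) = 0
      · rw [h0]; exact Real.sqrt_nonneg _
      · have hpos : 0 < Real.sqrt (∑ p' ∈ P, Ku p' ^ 2) :=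
          lt_of_le_of_ne (Real.sqrt_nonneg _) (Ne.symm h0)
        rw [sq] at h2
        exact le_of_mul_le_mul_right h2 hpos
    calc ∑ p'' ∈ P, Ku p'' ^ 2 = Real.sqrt (∑ p' ∈ P, Ku p' ^ 2) ^ 2 := (Real.sq_sqrt hA).symm
      _ ≤ Real.sqrt (∑ p' ∈ P, u p' ^ 2) ^ 2 := pow_le_pow_left₀ (Real.sqrt_nonneg _) h3 2
      _ = ∑ p ∈ P, u p ^ 2 := Real.sq_sqrt hB
  rw [hvw]
  have hcs1 : |∑ p'' ∈ P, Kv p'' * Kw p''| ≤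
      Real.sqrt (∑ p'' ∈ P, Kv p'' ^ 2) * Real.sqrt (∑ p'' ∈ P, Kw p'' ^ 2) := by
    rw [abs_le]
    constructor
    · have h := Real.sum_mul_le_sqrt_mul_sqrt P (fun p'' => -Kv p'') Kw
      have e1 : ∑ p'' ∈ P, (fun p'' => -Kv p'') p'' ^ 2 = ∑ p'' ∈ P, Kv p'' ^ 2 :=
        Finset.sum_congr rfl fun _ _ => by ring
      have e2 : ∑ p'' ∈ P, (fun p'' => -Kv p'') p'' * Kw p'' = -∑ p'' ∈ P, Kv p'' * Kw p'' := by
        rw [← Finset.sum_neg_distrib]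
        exact Finset.sum_congr rfl fun _ _ => by ring
      rw [e1, e2] at h
      linarith
    · exact Real.sum_mul_le_sqrt_mul_sqrt P Kv Kw
  have hv : Real.sqrt (∑ p'' ∈ P, Kv p'' ^ 2) ≤ Real.sqrt (∑ p ∈ P, v p ^ 2) :=
    Real.sqrt_le_sqrt (hnorm v)
  have hw : Real.sqrt (∑ p'' ∈ P, Kw p'' ^ 2) ≤ Real.sqrt (∑ p ∈ P, w p ^ 2) := by
    refine Real.sqrt_le_sqrt ?_
    have e : ∑ p'' ∈ P, Kw p'' ^ 2 = ∑ p'' ∈ P, (∑ p ∈ P, w p * K p p'') ^ 2 :=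
      Finset.sum_congr rfl fun p'' _ => by rw [hKw']
    rw [e]; exact hnorm w
  calc |∑ p'' ∈ P, Kv p'' * Kw p''|
      ≤ Real.sqrt (∑ p'' ∈ P, Kv p'' ^ 2) * Real.sqrt (∑ p'' ∈ P, Kw p'' ^ 2) := hcs1
    _ ≤ Real.sqrt (∑ p ∈ P, v p ^ 2) * Real.sqrt (∑ p ∈ P, w p ^ 2) :=
        mul_le_mul hv hw (Real.sqrt_nonneg _) (Real.sqrt_nonneg _)

variable [DecidableEq α]

/-- **The comparison identity with error.**  Let `p, q ∈ P` and suppose the point masses split on `P` as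
`δ_q = λ·s_q + n_q + v_q`, `δ_p = λ·s_p + n_p + v_p` with `n_q, n_p` orthogonal to all curls.  Then
`|K(p,q) − λ_p·s_q| ≤ Σ_{p'∈P} |λ_{p'}·s_p| |v_q(p')| + ‖v_p‖ ‖v_q‖`. -/
theorem abs_gramKernel_sub_le (hQ : Q = ∑ p ∈ P, vecMulVec (lam p) (lam p)) (hQd : Q.PosDef)
    (hK : ∀ p q, K p q = lam p ⬝ᵥ Q⁻¹ *ᵥ lam q) {p q : α} (hp : p ∈ P) (hq : q ∈ P)
    {sp sq : ι → ℝ} {np nq vp vq : α → ℝ}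
    (hδq : ∀ p' ∈ P, (if p' = q then (1 : ℝ) else 0) = lam p' ⬝ᵥ sq + nq p' + vq p')
    (hδp : ∀ p' ∈ P, (if p' = p then (1 : ℝ) else 0) = lam p' ⬝ᵥ sp + np p' + vp p')
    (hnq : ∀ s : ι → ℝ, ∑ p' ∈ P, nq p' * (lam p' ⬝ᵥ s) = 0)
    (hnp : ∀ s : ι → ℝ, ∑ p' ∈ P, np p' * (lam p' ⬝ᵥ s) = 0) :
    |K p q - lam p ⬝ᵥ sq| ≤
      ∑ p' ∈ P, |lam p' ⬝ᵥ sp| * |vq p'| +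
        Real.sqrt (∑ p' ∈ P, vp p' ^ 2) * Real.sqrt (∑ p' ∈ P, vq p' ^ 2) := by
  -- expand `K(x, y) = Σ_{p'} K(x,p') δ_y(p')` for `y ∈ P`
  have hexp : ∀ (x y : α), y ∈ P → ∀ {sy : ι → ℝ} {ny vy : α → ℝ},
      (∀ p' ∈ P, (if p' = y then (1 : ℝ) else 0) = lam p' ⬝ᵥ sy + ny p' + vy p') →
      (∀ s : ι → ℝ, ∑ p' ∈ P, ny p' * (lam p' ⬝ᵥ s) = 0) →
      K x y = lam x ⬝ᵥ sy + ∑ p' ∈ P, K x p' * vy p' := by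
    intro x y hy sy ny vy hδ hn
    have h0 : K x y = ∑ p' ∈ P, K x p' * (if p' = y then (1 : ℝ) else 0) := by
      simp only [mul_ite, mul_one, mul_zero, Finset.sum_ite_eq', if_pos hy]
    rw [h0]
    have h1 : ∑ p' ∈ P, K x p' * (if p' = y then (1 : ℝ) else 0) =
        ∑ p' ∈ P, (K x p' * (lam p' ⬝ᵥ sy) + K x p' * ny p' + K x p' * vy p') :=
      Finset.sum_congr rfl fun p' hp' => by rw [hδ p' hp']; ring
    rw [h1, Finset.sum_add_distrib, Finset.sum_add_distrib, gramKernel_reproducing hQ hQd hK,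
      gramKernel_annihilates hQ hK hn, add_zero]
  have hKpq := hexp p q hq hδq hnq
  -- the remainder `Σ_{p'} K(p,p') v_q(p') = Σ_{p'} (λ_{p'}·s_p) v_q(p') + Σ Σ v_p K v_q`
  have hrem : ∑ p' ∈ P, K p p' * vq p' =
      ∑ p' ∈ P, (lam p' ⬝ᵥ sp) * vq p' + ∑ p'' ∈ P, ∑ p' ∈ P, vp p'' * K p'' p' * vq p' := by
    have h1 : ∀ p' ∈ P, K p p' * vq p' =
        (lam p' ⬝ᵥ sp) * vq p' + (∑ p'' ∈ P, K p' p'' * vp p'') * vq p' := by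
      intro p' hp'
      rw [gramKernel_comm hQ hK p p', hexp p' p hp hδp hnp]
      ring
    rw [Finset.sum_congr rfl h1, Finset.sum_add_distrib, Finset.sum_comm]
    congr 1
    refine Finset.sum_congr rfl fun p' _ => ?_
    rw [Finset.sum_mul]
    exact Finset.sum_congr rfl fun p'' _ => by rw [gramKernel_comm hQ hK p' p'']; ring
  rw [hKpq, hrem]
  have e : lam p ⬝ᵥ sq + (∑ p' ∈ P, (lam p' ⬝ᵥ sp) * vq p' +
      ∑ p'' ∈ P, ∑ p' ∈ P, vp p'' * K p'' p' * vq p') - lam p ⬝ᵥ sq =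
      ∑ p' ∈ P, (lam p' ⬝ᵥ sp) * vq p' + ∑ p'' ∈ P, ∑ p' ∈ P, vp p'' * K p'' p' * vq p' := by ring
  rw [e]
  refine (abs_add_le _ _).trans (add_le_add ?_ (abs_sum_sum_gramKernel_le hQ hQd hK vp vq))
  refine (Finset.abs_sum_le_sum_abs _ _).trans (le_of_eq (Finset.sum_congr rfl fun p' _ => abs_mul _ _))

end GramKernel

end Summit.QuantumFields.YangMills.Theorems.WeakCouplingRates
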